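import Summits.QuantumFields.GaugeBoot.PeriodicEquipartitionFunctional
import Summits.QuantumFields.GaugeBoot.ZdPlaquetteInsertion
import HarnessLib

/-!
# Gauge-boot: THE EQUIPARTITION BOUND ON THE INFINITE LATTICE `ℤ^d` — every feasible point of the
# Anderson–Kruczenski / Kazakov–Zheng word SDP on `ℤ^d` at level `≥ 4` obeys
# `Σ_{P∋l} φ(u_P) ≤ 2(d−1)(1 − (N−1/N)/(4(d−1)β + N−1/N))` (large-`N` supplement 19, part 4)

HONEST FRAMING (cell `pub-gaugeboot`, page 1 of every file): certified bounds on lattice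
expectations at STATED coupling, gauge group, dimension and torus size; NOT a mass gap, NOT a
continuum limit, NOT a string tension, NOT large `N`; NOT Yang–Mills-summit-bearing (barriers
`FixedCouplingUltralocality`, `PerturbativeInvisibility`).  A statement about what EVERY feasible point of the
infinite-lattice truncated bootstrap satisfies — an a-priori ceiling on its upper bounds; it certifies no number of
CERTIFIED.md.

## Content

The `ℤ^d` twin of `EquipartitionBootstrap.lean` (supplement 18, part 5d), for the SDP the infinite-lattice
bootstrap literature actually runs: `IsBootstrapFeasible (fundamentalLatticeRep N) (suExp N)
(fun e => wilsonBoundaryAction (fundamentalRep (Fin N)) {e}) β (wordTruncation n)` on `LGConfig d SU(N)` — normalisation,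
positivity on squares of words of length `≤ n` in the link variables of `ℤ^d`, and the one-link Schwinger–Dyson rows with
the BOUNDARY actions `S_{l}` (`BootstrapTranslationReductionZd`, `BootstrapBoundsConvergenceZd`):

* `TiltedRP.entriesIn_stepIns`, `TiltedRP.entriesIn_insDeriv` — on any periodic lattice `(A, e)` the insertion
  derivative of a word holonomy has word entries of the word's length;
* `plaquetteZdCM r y i j` — the normalised plaquette `(1/N) Re tr ρ(U_{y;ij})` of `ℤ^d` as a continuous observable
  (a level-`m` test function for `m ≥ 4`, `plaquetteZdCM_mem_wordTruncation`); `plaquetteZdCM_apply_eq_plaqWord_true`,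
  `plaquetteZdCM_sub_apply_eq_plaqWord_false`, `evalR_plaqWord_true/false` — the two plaquette words through `(x, a)`
  in the plane `(a, ν)` are the plaquettes at `x` and at `x − e_ν`;
* ★★ `sdPairF_of_isBootstrapFeasible_zdSuN` — a level-`n` feasible functional has the pair rows
  (`TiltedRP.SDPairF … (zdUnit d)`) for every word of length `≤ n` and every traceless direction (chain rule through
  `Re/Im tr(Y·)`, uniqueness of the derivative of `S_{l}` = `actionDerivZd = −½ plaqIns`, polarisation);
* ★★★ `sum_plaquette_le_of_isBootstrapFeasible_zdSuN` — for `N ≥ 2`, `d ≥ 2`, tree coupling `β ≥ 0`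
  (`β = β_std/N`), every link `(x, a)` of `ℤ^d` and EVERY functional `φ` feasible at ANY level `n ≥ 4`:
  **`Σ_{ν ≠ a} (φ(u_{x;aν}) + φ(u_{x−e_ν;aν})) ≤ 2(d−1)·(1 − (N − 1/N)/(4(d−1)β + N − 1/N))`** — the `2(d−1)`
  plaquettes containing the link; `avg_plaquette_le_of_isBootstrapFeasible_zdSuN` (the average form).
So no certificate of the infinite-lattice SDP at level `≥ 4` can put the link-averaged plaquette above
`1 − (N² − 1)/(4(d−1)β_std + N² − 1)`; part 5 draws the consequences for DLR states and the symmetry-reduced SDPs.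
[folklore]
-/

noncomputable section

open Filter Topology NormedSpace
open scoped Matrix.Norms.Frobenius Matrix
open Literature.MathematicalPhysics.QuantumFieldTheory (LatticeRep)
open Literature.Probability.LatticeModels (Site)
open Literature.MathematicalPhysics.QuantumLattice (fundamentalLatticeRep fundamentalRep fundamentalLatticeRep_N LGConfig
  ZdEdge plaquetteObs plaquetteHolonomyZd wilsonBoundaryAction)

namespace Summit.QuantumFields.GaugeBoot

namespace TiltedRP

/-! ## The insertion derivative has word entries (any periodic lattice) -/

section Entries

variable {A : Type} [AddCommGroup A] [DecidableEq A] {d : ℕ} {G : Type} [Group G] [TopologicalSpace G]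
  (r : LatticeRep G) (e : Fin d → A)

/-- The one-step insertion `stepIns` (`X ρ(U_l)`, `ρ(U_l⁻¹)(−X)` or `0`) has entries of degree `1`. [folklore] -/
theorem entriesIn_stepIns (l : Link A d) (X : Matrix (Fin r.N) (Fin r.N) ℂ) (x : A) (s : Step d) :
    EntriesIn r (Set.univ : Set (Link A d)) 1 (fun U : Config A d G => stepIns r.ρ e l X U x s) := by
  have hfwd : EntriesIn r (Set.univ : Set (Link A d)) 1 (fun U : Config A d G => X * r.ρ (U l)) := by
    simpa using (entriesIn_const r (Set.univ : Set (Link A d)) 0 X).mul r (entriesIn_rho r (Set.mem_univ l) le_rfl)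
  have hbwd : EntriesIn r (Set.univ : Set (Link A d)) 1 (fun U : Config A d G => r.ρ ((U l)⁻¹) * (-X)) := by
    simpa using (entriesIn_rho_inv r (Set.mem_univ l) le_rfl).mul r (entriesIn_const r (Set.univ : Set (Link A d)) 0 (-X))
  have hzero : EntriesIn r (Set.univ : Set (Link A d)) 1 (fun _ : Config A d G => (0 : Matrix (Fin r.N) (Fin r.N) ℂ)) :=
    entriesIn_const r _ 1 0
  by_cases h : s.link e x = l
  · cases s with
    | fwd ν =>
      have hfun : (fun U : Config A d G => stepIns r.ρ e l X U x (.fwd ν)) = fun U => X * r.ρ (U l) := by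
        funext U; rw [stepIns, if_pos h, Step.isFwd_fwd, if_pos rfl]
      rw [hfun]; exact hfwd
    | bwd ν =>
      have hfun : (fun U : Config A d G => stepIns r.ρ e l X U x (.bwd ν)) = fun U => r.ρ ((U l)⁻¹) * (-X) := by
        funext U; rw [stepIns, if_pos h, Step.isFwd_bwd, if_neg (by decide)]
      rw [hfun]; exact hbwd
  · have hfun : (fun U : Config A d G => stepIns r.ρ e l X U x s) = fun _ => 0 := by
      funext U; rw [stepIns, if_neg h]
    rw [hfun]; exact hzero

/-- ★ **The insertion derivative of `ρ(hol_w)` has word entries of degree `|w|`** (periodic lattice). [folklore] -/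
theorem entriesIn_insDeriv (l : Link A d) (X : Matrix (Fin r.N) (Fin r.N) ℂ) :
    ∀ (x : A) (w : Word d),
      EntriesIn r (Set.univ : Set (Link A d)) w.length (fun U : Config A d G => insDeriv r.ρ e l X U x w)
  | x, [] => by
    simpa only [insDeriv_nil, List.length_nil] using entriesIn_const r (Set.univ : Set (Link A d)) 0 0
  | x, s :: w => by
    have h1 := (entriesIn_stepIns r e l X x s).mul r (entriesIn_wordHolonomy r e (s.move e x) w)
    have h2 := (entriesIn_stepHolonomy r e x s).mul r (entriesIn_insDeriv l X (s.move e x) w)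
    have h := h1.add r h2
    rw [Nat.add_comm] at h
    simpa only [insDeriv_cons, List.length_cons] using h

end Entries

/-! ## The plaquette observable of `ℤ^d` and the two plaquette words through a link -/

section Plaquette

variable {d : ℕ} {G : Type} [Group G] [TopologicalSpace G] [IsTopologicalGroup G] (r : LatticeRep G)

/-- **The normalised plaquette `u_{y;ij} = (1/N) Re tr ρ(U_{y;ij})` of `ℤ^d` as a continuous observable**
(`plaquetteObs` of `LatticeGaugeDLR`, divided by `N`). [folklore] -/
def plaquetteZdCM (y : Site d) (i j : Fin d) : C(LGConfig d G, ℝ) :=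
  ⟨fun U => (r.N : ℝ)⁻¹ * plaquetteObs r.ρ y i j U, by
    have h : Continuous fun U : LGConfig d G => plaquetteHolonomyZd U y i j := by
      unfold plaquetteHolonomyZd; fun_prop
    exact continuous_const.mul (Complex.continuous_re.comp ((r.continuous.comp h).matrix_trace))⟩

/-- Evaluation. [folklore] -/
@[simp] theorem plaquetteZdCM_apply (y : Site d) (i j : Fin d) (U : LGConfig d G) :
    plaquetteZdCM r y i j U = (r.N : ℝ)⁻¹ * plaquetteObs r.ρ y i j U := rfl

/-- **The `+`-oriented plaquette word through `(x, a)` in the plane `(a, ν)` is the plaquette at `x`**: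
`u_{x;aν}(U) = (1/N) Re tr ρ(hol_x P̃_{ν,+})`. [folklore] -/
theorem plaquetteZdCM_apply_eq_plaqWord_true (x : Site d) (a ν : Fin d) (U : LGConfig d G) :
    plaquetteZdCM r x a ν U = (r.N : ℝ)⁻¹ * (r.ρ (wordHolonomy (zdUnit d) U x (plaqWord a ν true))).trace.re := by
  rw [plaquetteZdCM_apply, Equipartition.re_trace_plaqWord_true, holonomy_zdUnit, plaquetteObs]

/-- **The `−`-oriented plaquette word through `(x, a)` in the plane `(a, ν)` is the plaquette at `x − e_ν`**
(unitary `ρ`): `u_{x−e_ν;aν}(U) = (1/N) Re tr ρ(hol_x P̃_{ν,−})`. [folklore] -/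
theorem plaquetteZdCM_sub_apply_eq_plaqWord_false (x : Site d) (a ν : Fin d) (U : LGConfig d G) :
    plaquetteZdCM r (x - zdUnit d ν) a ν U =
      (r.N : ℝ)⁻¹ * (r.ρ (wordHolonomy (zdUnit d) U x (plaqWord a ν false))).trace.re := by
  have hx : x = (x - zdUnit d ν) + zdUnit d ν := (sub_add_cancel x (zdUnit d ν)).symm
  rw [plaquetteZdCM_apply, plaquetteObs, ← holonomy_zdUnit,
    ← Equipartition.re_trace_plaqWord_false (zdUnit d) r.mem_unitary U (x - zdUnit d ν) a ν, ← hx]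

/-- ★ **The plaquette observable is a level-`m` test function of the word truncation for every `m ≥ 4`.** [folklore] -/
theorem plaquetteZdCM_mem_wordTruncation {m : ℕ} (hm : 4 ≤ m) (x : Site d) (a ν : Fin d) :
    plaquetteZdCM r x a ν ∈ wordTruncation (ι := ZdEdge d) r m := by
  obtain ⟨g, hg, hg'⟩ := (mem_wordFunctions_iff r).1 (entriesIn_plaqWord r (zdUnit d) x a ν true).trace_re
  have hgV : g ∈ wordTruncation (ι := ZdEdge d) r m :=
    wordTruncation_mono r hm (mem_wordTruncation_of_mem_wordSpace r hg)
  have heq : plaquetteZdCM r x a ν = (r.N : ℝ)⁻¹ • g := by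
    ext U
    rw [ContinuousMap.smul_apply, plaquetteZdCM_apply_eq_plaqWord_true, smul_eq_mul, show g U = _ from congrFun hg' U]
  rw [heq]
  exact Submodule.smul_mem _ _ hgV

variable (φ : C(LGConfig d G, ℝ) →ₗ[ℝ] ℝ)

/-- Under a functional: the `+` word through `(x, a)` in the plane `(a, ν)` gives `φ(u_{x;aν})`. [folklore] -/
theorem evalR_plaqWord_true (x : Site d) (a ν : Fin d) :
    evalR φ (fun U : LGConfig d G => (r.N : ℝ)⁻¹ * (r.ρ (wordHolonomy (zdUnit d) U x (plaqWord a ν true))).trace.re) =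
      φ (plaquetteZdCM r x a ν) := by
  have h : (fun U : LGConfig d G => (r.N : ℝ)⁻¹ * (r.ρ (wordHolonomy (zdUnit d) U x (plaqWord a ν true))).trace.re) =
      ⇑(plaquetteZdCM r x a ν) := by
    funext U; rw [plaquetteZdCM_apply_eq_plaqWord_true]
  rw [h, evalR_coe]

/-- Under a functional: the `−` word through `(x, a)` in the plane `(a, ν)` gives `φ(u_{x−e_ν;aν})`. [folklore] -/
theorem evalR_plaqWord_false (x : Site d) (a ν : Fin d) :
    evalR φ (fun U : LGConfig d G => (r.N : ℝ)⁻¹ * (r.ρ (wordHolonomy (zdUnit d) U x (plaqWord a ν false))).trace.re) =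
      φ (plaquetteZdCM r (x - zdUnit d ν) a ν) := by
  have h : (fun U : LGConfig d G => (r.N : ℝ)⁻¹ * (r.ρ (wordHolonomy (zdUnit d) U x (plaqWord a ν false))).trace.re) =
      ⇑(plaquetteZdCM r (x - zdUnit d ν) a ν) := by
    funext U; rw [plaquetteZdCM_sub_apply_eq_plaqWord_false]
  rw [h, evalR_coe]

end Plaquette

/-! ## Feasible functionals of the `SU(N)` word SDP on `ℤ^d` have the pair rows -/

section ZdSuN

variable {d N : ℕ}

/-- ★★ **A level-`n` feasible functional of the `SU(N)` word SDP on `ℤ^d` has the pair rows** (`TiltedRP.SDPairF` at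
`e = zdUnit`) for every word of length `≤ n` and every traceless direction `X`. [folklore] -/
theorem sdPairF_of_isBootstrapFeasible_zdSuN {n : ℕ} {β : ℝ}
    {φ : C(LGConfig d (Matrix.specialUnitaryGroup (Fin N) ℂ), ℝ) →ₗ[ℝ] ℝ}
    (hφ : IsBootstrapFeasible (fundamentalLatticeRep N) (suExp N)
      (fun e => wilsonBoundaryAction (fundamentalRep (Fin N)) {e}) β
      (wordTruncation (ι := ZdEdge d) (fundamentalLatticeRep N) n) φ)
    (x : Site d) (μ : Fin d) (x₀ : Site d) (w : Word d) (hw : w.length ≤ n)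
    (X : Matrix (Fin N) (Fin N) ℂ) (hX0 : X.trace = 0) :
    SDPairF (fundamentalLatticeRep N) (zdUnit d) φ β x μ x₀ w X := by
  refine sdPairF_of_traceless (fundamentalLatticeRep N) (zdUnit d) φ β x μ x₀ w (fun Z hZs hZ0 => ?_) X hX0
  clear hX0 X
  -- the direction as a generator of `SU(N)`
  have hZskew : (Z : Matrix (Fin N) (Fin N) ℂ) ∈ skewAdjoint (Matrix (Fin N) (Fin N) ℂ) := by
    change star Z = -Z
    rw [Matrix.star_eq_conjTranspose]; exact hZs
  let Zg : SuGenerator N := ⟨Z, hZskew, hZ0⟩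
  have hk : ∀ s t, suExp N Zg (s + t) = suExp N Zg s * suExp N Zg t := suExp_add N Zg
  have hkX : ∀ t, (fundamentalLatticeRep N).ρ (suExp N Zg t) = exp ((t : ℂ) • Z) := fun t => rho_suExp N Zg t
  -- the action derivative of the feasibility witness is `actionDerivZd`
  obtain ⟨S', -, hS'der, hrows⟩ := hφ.2.2 (x, μ) Zg
  have hS' : ∀ U, S' U = actionDerivZd (fundamentalLatticeRep N).ρ (x, μ) Z U := fun U =>
    (hS'der U).unique (hasDerivAt_wilsonBoundaryAction (x, μ) hk hkX U)
  intro Y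
  -- the test functions `Re/Im tr(Y ρ(hol_w))` and their derivatives `Re/Im tr(Y insDeriv)` are word functions
  have hV : EntriesIn (fundamentalLatticeRep N) (Set.univ : Set (ZdEdge d)) w.length
      (fun U : LGConfig d _ => Y * (fundamentalLatticeRep N).ρ (wordHolonomy (zdUnit d) U x₀ w)) := by
    simpa only [zero_add] using (entriesIn_const (fundamentalLatticeRep N) (Set.univ : Set (ZdEdge d)) 0 Y).mul
      (fundamentalLatticeRep N) (entriesIn_wordHolonomy (fundamentalLatticeRep N) (zdUnit d) x₀ w)
  have hD : EntriesIn (fundamentalLatticeRep N) (Set.univ : Set (ZdEdge d)) w.length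
      (fun U : LGConfig d _ => Y * insDeriv (fundamentalLatticeRep N).ρ (zdUnit d) (x, μ) Z U x₀ w) := by
    simpa only [zero_add] using (entriesIn_const (fundamentalLatticeRep N) (Set.univ : Set (ZdEdge d)) 0 Y).mul
      (fundamentalLatticeRep N) (entriesIn_insDeriv (fundamentalLatticeRep N) (zdUnit d) (x, μ) Z x₀ w)
  obtain ⟨gre, hgre, hgre'⟩ := (mem_wordFunctions_iff (fundamentalLatticeRep N)).1 hV.trace_re
  obtain ⟨gim, hgim, hgim'⟩ := (mem_wordFunctions_iff (fundamentalLatticeRep N)).1 (hV.trace_im (fundamentalLatticeRep N))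
  obtain ⟨dre, hdre, hdre'⟩ := (mem_wordFunctions_iff (fundamentalLatticeRep N)).1 hD.trace_re
  obtain ⟨dim, hdim, hdim'⟩ := (mem_wordFunctions_iff (fundamentalLatticeRep N)).1 (hD.trace_im (fundamentalLatticeRep N))
  have hgreV : gre ∈ wordTruncation (ι := ZdEdge d) (fundamentalLatticeRep N) n :=
    wordTruncation_mono (fundamentalLatticeRep N) hw (mem_wordTruncation_of_mem_wordSpace (fundamentalLatticeRep N) hgre)
  have hgimV : gim ∈ wordTruncation (ι := ZdEdge d) (fundamentalLatticeRep N) n :=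
    wordTruncation_mono (fundamentalLatticeRep N) hw (mem_wordTruncation_of_mem_wordSpace (fundamentalLatticeRep N) hgim)
  -- the derivative facts along the shift `U ↦ U[l ↦ e^{tZ} U_l]` (chain rule with a real-linear map)
  have hder_re : ∀ U : LGConfig d (Matrix.specialUnitaryGroup (Fin N) ℂ),
      HasDerivAt (fun t : ℝ => gre (Function.update U (x, μ) (suExp N Zg t * U (x, μ)))) (dre U) 0 := by
    intro U
    have h1 := hasDerivAt_wordHolonomy (zdUnit d) (x, μ) hk hkX U x₀ w
    have h2 := (Complex.reCLM.comp (traceMulLeftCLM Y)).hasFDerivAt.comp_hasDerivAt (0 : ℝ) h1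
    have e1 : (fun t : ℝ => gre (Function.update U (x, μ) (suExp N Zg t * U (x, μ)))) =
        (⇑(Complex.reCLM.comp (traceMulLeftCLM Y)) ∘ fun t : ℝ =>
          (fundamentalLatticeRep N).ρ (wordHolonomy (zdUnit d) (Function.update U (x, μ) (suExp N Zg t * U (x, μ))) x₀ w)) := by
      funext t
      simp only [Function.comp_apply, ContinuousLinearMap.comp_apply, traceMulLeftCLM_apply, Complex.reCLM_apply, hgre']
    have e2 : dre U = (Complex.reCLM.comp (traceMulLeftCLM Y))
        (insDeriv (fundamentalLatticeRep N).ρ (zdUnit d) (x, μ) Z U x₀ w) := by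
      simp only [ContinuousLinearMap.comp_apply, traceMulLeftCLM_apply, Complex.reCLM_apply, hdre']
    rw [e1, e2]
    exact h2
  have hder_im : ∀ U : LGConfig d (Matrix.specialUnitaryGroup (Fin N) ℂ),
      HasDerivAt (fun t : ℝ => gim (Function.update U (x, μ) (suExp N Zg t * U (x, μ)))) (dim U) 0 := by
    intro U
    have h1 := hasDerivAt_wordHolonomy (zdUnit d) (x, μ) hk hkX U x₀ w
    have h2 := (Complex.imCLM.comp (traceMulLeftCLM Y)).hasFDerivAt.comp_hasDerivAt (0 : ℝ) h1
    have e1 : (fun t : ℝ => gim (Function.update U (x, μ) (suExp N Zg t * U (x, μ)))) =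
        (⇑(Complex.imCLM.comp (traceMulLeftCLM Y)) ∘ fun t : ℝ =>
          (fundamentalLatticeRep N).ρ (wordHolonomy (zdUnit d) (Function.update U (x, μ) (suExp N Zg t * U (x, μ))) x₀ w)) := by
      funext t
      simp only [Function.comp_apply, ContinuousLinearMap.comp_apply, traceMulLeftCLM_apply, Complex.imCLM_apply, hgim']
    have e2 : dim U = (Complex.imCLM.comp (traceMulLeftCLM Y))
        (insDeriv (fundamentalLatticeRep N).ρ (zdUnit d) (x, μ) Z U x₀ w) := by
      simp only [ContinuousLinearMap.comp_apply, traceMulLeftCLM_apply, Complex.imCLM_apply, hdim']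
    rw [e1, e2]
    exact h2
  -- the rows
  have hrow_re := hrows gre hgreV dre (mem_polyAlgebra_of_mem_wordSpace (fundamentalLatticeRep N) hdre) hder_re
  have hrow_im := hrows gim hgimV dim (mem_polyAlgebra_of_mem_wordSpace (fundamentalLatticeRep N) hdim) hder_im
  -- the right-hand side `tr(Y ρ(hol_w))·(−½ plaqIns_Z)` is `tr(Y ρ(hol_w))·S'` (a real factor)
  have hrhs : ∀ U, (Y * (fundamentalLatticeRep N).ρ (wordHolonomy (zdUnit d) U x₀ w)).trace *
      (-(1 / 2) * plaqIns (fundamentalLatticeRep N).ρ (zdUnit d) Z U x μ) =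
      (Y * (fundamentalLatticeRep N).ρ (wordHolonomy (zdUnit d) U x₀ w)).trace * ((S' U : ℝ) : ℂ) := fun U => by
    rw [hS' U, actionDerivZd_eq_plaqIns hZs (fundamentalLatticeRep N).mem_unitary U x μ]
  have hLre : evalR φ (fun U => ((Y * insDeriv (fundamentalLatticeRep N).ρ (zdUnit d) (x, μ) Z U x₀ w).trace).re) =
      φ dre := by
    rw [← hdre', evalR_coe]
  have hLim : evalR φ (fun U => ((Y * insDeriv (fundamentalLatticeRep N).ρ (zdUnit d) (x, μ) Z U x₀ w).trace).im) =
      φ dim := by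
    rw [← hdim', evalR_coe]
  have hRre : evalR φ (fun U => ((Y * (fundamentalLatticeRep N).ρ (wordHolonomy (zdUnit d) U x₀ w)).trace *
      (-(1 / 2) * plaqIns (fundamentalLatticeRep N).ρ (zdUnit d) Z U x μ)).re) = φ (gre * S') := by
    have e1 : (fun U => ((Y * (fundamentalLatticeRep N).ρ (wordHolonomy (zdUnit d) U x₀ w)).trace *
        (-(1 / 2) * plaqIns (fundamentalLatticeRep N).ρ (zdUnit d) Z U x μ)).re) = ⇑(gre * S') := by
      funext U
      rw [hrhs U, Complex.re_mul_ofReal, ContinuousMap.mul_apply, hgre']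
    rw [e1, evalR_coe]
  have hRim : evalR φ (fun U => ((Y * (fundamentalLatticeRep N).ρ (wordHolonomy (zdUnit d) U x₀ w)).trace *
      (-(1 / 2) * plaqIns (fundamentalLatticeRep N).ρ (zdUnit d) Z U x μ)).im) = φ (gim * S') := by
    have e1 : (fun U => ((Y * (fundamentalLatticeRep N).ρ (wordHolonomy (zdUnit d) U x₀ w)).trace *
        (-(1 / 2) * plaqIns (fundamentalLatticeRep N).ρ (zdUnit d) Z U x μ)).im) = ⇑(gim * S') := by
      funext U
      rw [hrhs U, Complex.im_mul_ofReal, ContinuousMap.mul_apply, hgim']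
    rw [e1, evalR_coe]
  apply Complex.ext
  · rw [evalC_re, hLre, Complex.re_ofReal_mul, evalC_re, hRre, hrow_re]
  · rw [evalC_im, hLim, Complex.im_ofReal_mul, evalC_im, hRim, hrow_im]

/-- The unit vectors of `ℤ^d` are non-zero (the periodic hypothesis `e ν ≠ 0` on `ℤ^d`). [folklore] -/
theorem zdUnit_ne_zero (ν : Fin d) : zdUnit d ν ≠ 0 := by
  intro h
  have h' := congrFun h ν
  simp at h'

namespace Equipartition

/-- ★★★ **THE EQUIPARTITION BOUND AT EVERY FEASIBLE POINT OF THE `SU(N)` WORD SDP ON `ℤ^d`.**  For `N ≥ 2`,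
`d ≥ 2`, tree coupling `β ≥ 0`, every link `(x, a)` of the infinite lattice and every functional `φ` feasible for the
word-level-`n` bootstrap on `ℤ^d` (one-link Wilson boundary actions) with `n ≥ 4`:
`Σ_{ν ≠ a} (φ(u_{x;aν}) + φ(u_{x−e_ν;aν})) ≤ 2(d−1)·(1 − (N − 1/N)/(4(d−1)β + N − 1/N))` — the sum over the `2(d−1)`
plaquettes containing the link, `u = plaquetteZdCM` the normalised plaquette. [folklore] -/
theorem sum_plaquette_le_of_isBootstrapFeasible_zdSuN (hN : 2 ≤ N) {n : ℕ} (hn : 4 ≤ n) (hd : 2 ≤ d) {β : ℝ}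
    (hβ : 0 ≤ β) {φ : C(LGConfig d (Matrix.specialUnitaryGroup (Fin N) ℂ), ℝ) →ₗ[ℝ] ℝ}
    (hφ : IsBootstrapFeasible (fundamentalLatticeRep N) (suExp N)
      (fun e => wilsonBoundaryAction (fundamentalRep (Fin N)) {e}) β
      (wordTruncation (ι := ZdEdge d) (fundamentalLatticeRep N) n) φ)
    (x : Site d) (a : Fin d) :
    (∑ ν ∈ Finset.univ.erase a, (φ (plaquetteZdCM (fundamentalLatticeRep N) x a ν) +
        φ (plaquetteZdCM (fundamentalLatticeRep N) (x - zdUnit d ν) a ν))) ≤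
      2 * ((d : ℝ) - 1) * (1 - ((N : ℝ) - 1 / N) / (4 * ((d : ℝ) - 1) * β + ((N : ℝ) - 1 / N))) := by
  have hN2 : (1 : ℝ) < ((fundamentalLatticeRep N).N : ℝ) ^ 2 := by
    rw [fundamentalLatticeRep_N]
    have : (2 : ℝ) ≤ N := by exact_mod_cast hN
    nlinarith
  have hP : ∀ ν ∈ Finset.univ.erase a, ∀ (ε : Bool) (i j : Fin (fundamentalLatticeRep N).N),
      SDPairF (fundamentalLatticeRep N) (zdUnit d) φ β x a x (plaqWord a ν ε) (unitDir ((1 : ℝ) : ℂ) i j) := by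
    intro ν _ ε i j
    rw [Complex.ofReal_one]
    exact sdPairF_of_isBootstrapFeasible_zdSuN hφ x a x (plaqWord a ν ε) ((length_plaqWord a ν ε).trans_le hn) _
      (trace_unitDir_one i j)
  have h := sum_evalR_plaquette_le_of_sdPairF (fundamentalLatticeRep N) (zdUnit d) φ zdUnit_ne_zero hd hβ x a
    zero_le_one hN2 hn hφ.1 hφ.2.1 hP
  have hev : ∀ ν, (∑ ε : Bool, evalR φ (fun U => ((fundamentalLatticeRep N).N : ℝ)⁻¹ *
      ((fundamentalLatticeRep N).ρ (wordHolonomy (zdUnit d) U x (plaqWord a ν ε))).trace.re)) =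
      φ (plaquetteZdCM (fundamentalLatticeRep N) x a ν) +
        φ (plaquetteZdCM (fundamentalLatticeRep N) (x - zdUnit d ν) a ν) := fun ν => by
    rw [Fintype.sum_bool, evalR_plaqWord_true, evalR_plaqWord_false]
  simp only [hev] at h
  simpa [fundamentalLatticeRep_N] using h

/-- The same for the AVERAGE over the `2(d−1)` plaquettes containing the link:
`(1/(2(d−1)))·Σ_{ν≠a} (φ(u_{x;aν}) + φ(u_{x−e_ν;aν})) ≤ 1 − (N − 1/N)/(4(d−1)β + N − 1/N)`. [folklore] -/
theorem avg_plaquette_le_of_isBootstrapFeasible_zdSuN (hN : 2 ≤ N) {n : ℕ} (hn : 4 ≤ n) (hd : 2 ≤ d) {β : ℝ}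
    (hβ : 0 ≤ β) {φ : C(LGConfig d (Matrix.specialUnitaryGroup (Fin N) ℂ), ℝ) →ₗ[ℝ] ℝ}
    (hφ : IsBootstrapFeasible (fundamentalLatticeRep N) (suExp N)
      (fun e => wilsonBoundaryAction (fundamentalRep (Fin N)) {e}) β
      (wordTruncation (ι := ZdEdge d) (fundamentalLatticeRep N) n) φ)
    (x : Site d) (a : Fin d) :
    (2 * ((d : ℝ) - 1))⁻¹ * (∑ ν ∈ Finset.univ.erase a, (φ (plaquetteZdCM (fundamentalLatticeRep N) x a ν) +
        φ (plaquetteZdCM (fundamentalLatticeRep N) (x - zdUnit d ν) a ν))) ≤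
      1 - ((N : ℝ) - 1 / N) / (4 * ((d : ℝ) - 1) * β + ((N : ℝ) - 1 / N)) := by
  have hd0 : (0 : ℝ) < 2 * ((d : ℝ) - 1) := by
    have : (2 : ℝ) ≤ d := by exact_mod_cast hd
    linarith
  rw [inv_mul_le_iff₀ hd0]
  exact sum_plaquette_le_of_isBootstrapFeasible_zdSuN hN hn hd hβ hφ x a

/-- **Cell normalisation** (`β_tree = β_std/N`): the bound reads `1 − (N² − 1)/(4(d−1)β_std + N² − 1)`. [folklore] -/
theorem avg_plaquette_le_of_isBootstrapFeasible_zdSuN_std (hN : 2 ≤ N) {n : ℕ} (hn : 4 ≤ n) (hd : 2 ≤ d) {β : ℝ}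
    (hβ : 0 ≤ β) {φ : C(LGConfig d (Matrix.specialUnitaryGroup (Fin N) ℂ), ℝ) →ₗ[ℝ] ℝ}
    (hφ : IsBootstrapFeasible (fundamentalLatticeRep N) (suExp N)
      (fun e => wilsonBoundaryAction (fundamentalRep (Fin N)) {e}) (β / N)
      (wordTruncation (ι := ZdEdge d) (fundamentalLatticeRep N) n) φ)
    (x : Site d) (a : Fin d) :
    (2 * ((d : ℝ) - 1))⁻¹ * (∑ ν ∈ Finset.univ.erase a, (φ (plaquetteZdCM (fundamentalLatticeRep N) x a ν) +
        φ (plaquetteZdCM (fundamentalLatticeRep N) (x - zdUnit d ν) a ν))) ≤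
      1 - ((N : ℝ) ^ 2 - 1) / (4 * ((d : ℝ) - 1) * β + ((N : ℝ) ^ 2 - 1)) := by
  have hN0 : (0 : ℝ) < N := by exact_mod_cast (by omega : 0 < N)
  have hβ' : 0 ≤ β / N := div_nonneg hβ hN0.le
  have h := avg_plaquette_le_of_isBootstrapFeasible_zdSuN hN hn hd hβ' hφ x a
  have hid : ((N : ℝ) - 1 / N) / (4 * ((d : ℝ) - 1) * (β / N) + ((N : ℝ) - 1 / N)) =
      ((N : ℝ) ^ 2 - 1) / (4 * ((d : ℝ) - 1) * β + ((N : ℝ) ^ 2 - 1)) := by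
    have hd1 : (0 : ℝ) ≤ (d : ℝ) - 1 := by
      have : (2 : ℝ) ≤ d := by exact_mod_cast hd
      linarith
    have hN2 : (2 : ℝ) ≤ N := by exact_mod_cast hN
    have hN1 : (1 : ℝ) < (N : ℝ) ^ 2 := by nlinarith
    have hcpos : (0 : ℝ) < (N : ℝ) - 1 / N := by
      have h1 : 1 / (N : ℝ) ≤ 1 / 2 := one_div_le_one_div_of_le (by norm_num) hN2
      linarith
    have hK1 : (0 : ℝ) < 4 * ((d : ℝ) - 1) * (β / N) + ((N : ℝ) - 1 / N) :=
      add_pos_of_nonneg_of_pos (mul_nonneg (mul_nonneg (by norm_num) hd1) hβ') hcpos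
    have hK2 : (0 : ℝ) < 4 * ((d : ℝ) - 1) * β + ((N : ℝ) ^ 2 - 1) :=
      add_pos_of_nonneg_of_pos (mul_nonneg (mul_nonneg (by norm_num) hd1) hβ) (by linarith)
    rw [div_eq_div_iff hK1.ne' hK2.ne']
    field_simp
  rwa [hid] at h

end Equipartition

end ZdSuN

end TiltedRP

end Summit.QuantumFields.GaugeBoot

end
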